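import Summits.HubbardSuperconductivity.HubbardSuperconductivity.Theorems.FunctionFieldCertificateAssemblyFejerGlue
import Literature.MathematicalPhysics.QuantumLattice.PairFieldMomentum
import HarnessLib

/-!
# Crux `WindowInfraredBound` (stmt-HubbardSuperconductivity-1089) — the MESOSCOPIC-CEILING glue, file 1 of 2:
# the Fejér MAJORANT of the window (idea `mesoscopic-ceiling-block-coherence`, crux-ideation round 2, ideator 5)

Support file (`--supports stmt-HubbardSuperconductivity-1089`; no definition, no named fact, sorry-free; model-free:
nothing here mentions the Hubbard Hamiltonian). Both round-2 triagers of the crux asked for this glue to be landed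
(`Cruxes/WindowInfraredBound/TRIAGE-r2-1.md` "(MC) ↔ crux … land glue as supports, forward restatement",
`TRIAGE-r2-2.md` "glue lemmas worth landing as supports"); the ideator's sketch
`Cruxes/WindowInfraredBound/SketchIdeator5.lean` carries it with `sorry`s. File 2
(`FunctionFieldCertificateWindowInfraredBoundMesoscopicCeiling.lean`) composes it with the crux and the summit.

Notation. `P_x = localPair g L x`, blocks `B_a = Σ_{u ∈ [0,R)²} P_{a+u}`, `Δ_g(m) = pairFieldAt g L m`,
`S_ψ(m) = pairStructureFactor g L ψ m = ‖Δ_g(m)ψ‖²/L²`, and the Fejér-box pair correlation of route item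
`MesoscopicPairOrder`, `T_R(ψ) = Σ_{x,y} Πᵢ (1 - |(y-x)ᵢ|_L/R)₊ Re⟨P_x ψ, P_y ψ⟩` (so `Σ_a ‖B_a ψ‖² = R² T_R(ψ)`,
the tent identity `re_sum_star_blockMulVec_dotProduct_eq`), block kernel `F_R(m) = Σ_{u ∈ [0,R)²} χ_m(u)`,
`F_R(0) = R²`.

* `sq_mul_fejerBoxCorr_eq_sum_blockKernel_sq_mul` — block Plancherel in Fejér normalisation,
  `R² T_R(ψ) = Σ_m |F_R(m)|² S_ψ(m)` (any form factor, any vector).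
* `condensate_le_blockOrder` — kinematics: `S_ψ(0) ≤ T_R(ψ)/R²` for EVERY vector (the `m = 0` term), so the
  block-coherence defect `T_R(ψ)/R² - S_ψ(0) = R⁻⁴ Σ_{m ≠ 0} |F_R(m)|² S_ψ(m)` of the mesoscopic ceiling (MC) is
  a genuine nonnegative quantity (the Cauchy–Schwarz defect of the block pair-removal vectors `B_a ψ`).
* `windowSum_le_fejerMajorant` — the **Fejér MAJORANT of the window** (dual to the landed MINORANT
  `FunctionFieldCertificateAssembly.fejer_glue`): for `0 < R`, `2R ≤ L`, `0 < ε`, `ε R ≤ 1` and EVERY Fock vector,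
  `Σ_{m ≠ 0, |q_m| ≤ ε} S_ψ(m) ≤ 16 · (T_R(ψ)/R² - S_ψ(0))`, from the LOWER kernel bound `|F_R(m)|² ≥ R⁴/16` on
  the window (`|Σ_{v<R} e^{ivθ} - R| ≤ Σ_{v<R} v|θ| ≤ R²|θ|/2 ≤ R/2` for `R|θ| ≤ 1`, `mc_half_le_norm_sum_stdAddChar`).

Sources: Kennedy–Lieb–Shastry, PRL 61 (1988) 2582 (Fourier modes of an order operator, Parseval bookkeeping)
[KLS1988PRL]; Stein–Shakarchi, *Fourier Analysis*, Ch. 2 (Fejér kernel = autocorrelation of a box; kernel bounds);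
Friedli–Velenik (2017) §10.4 (Fourier analysis on `(ℤ/Lℤ)^d`). The block-Plancherel lemmas are adapted from
`Theorems/WeakCouplingBCSWcbcsSsbToTorusLROFejerClosure.lean` (private there). All folklore.
-/

noncomputable section

-- summit = problem name (single-conjunct summit, D-0017): `HubbardSuperconductivity` occurs twice in the path
set_option linter.dupNamespace false

namespace Summit.HubbardSuperconductivity.HubbardSuperconductivity.Theorems.WindowInfraredBound

open Literature.MathematicalPhysics.QuantumLattice Literature.Probability.LatticeModels Matrix Finset
open scoped ComplexConjugate ComplexOrder

/-! ### The one-dimensional block kernel from BELOW -/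

section Kernel

variable {L : ℕ} [NeZero L]

/-- The character of a multiple: `e(k·v) = exp(2πi n v / L)` with `n = valMinAbs k` the representative of
least absolute value (`e(k v) = e(k)^v`, `e(k) = exp(2πi n/L)`). [folklore] -/
private theorem mc_stdAddChar_mul_natCast (k : ZMod L) (v : ℕ) :
    (ZMod.stdAddChar (k * ((v : ℕ) : ZMod L)) : ℂ) =
      Complex.exp (Complex.I * ((2 * Real.pi * (k.valMinAbs : ℤ) * v / L : ℝ) : ℂ)) := by
  have hω : (ZMod.stdAddChar k : ℂ) = Complex.exp (2 * Real.pi * Complex.I * (k.valMinAbs : ℤ) / L) := by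
    have h := ZMod.stdAddChar_coe (N := L) k.valMinAbs
    rwa [ZMod.coe_valMinAbs] at h
  rw [mul_comm k, ← nsmul_eq_mul, AddChar.map_nsmul_eq_pow, hω, ← Complex.exp_nat_mul]
  congr 1
  push_cast
  ring

/-- **Lower kernel bound in one coordinate.** If `|q_k| · R ≤ 1` (`q_k = 2π valMinAbs k / L`), then
`R/2 ≤ |Σ_{v<R} e(k v)|`: each term is within `v |q_k|` of `1` (`|e^{ix} - 1| ≤ |x|`), and
`Σ_{v<R} v |q_k| ≤ R² |q_k| / 2 ≤ R/2`. Stein–Shakarchi, *Fourier Analysis*, Ch. 2. [folklore] -/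
private theorem mc_half_le_norm_sum_stdAddChar (k : ZMod L) (R : ℕ)
    (hq : |2 * Real.pi * ((k.valMinAbs : ℤ) : ℝ) / L| * R ≤ 1) :
    (R : ℝ) / 2 ≤ ‖∑ v : Fin R, (ZMod.stdAddChar (k * ((v : ℕ) : ZMod L)) : ℂ)‖ := by
  set θ : ℝ := 2 * Real.pi * ((k.valMinAbs : ℤ) : ℝ) / L with hθ
  -- each term is close to `1`
  have hterm : ∀ v : Fin R, ‖(ZMod.stdAddChar (k * ((v : ℕ) : ZMod L)) : ℂ) - 1‖ ≤ (v : ℕ) * |θ| := by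
    intro v
    rw [mc_stdAddChar_mul_natCast]
    refine (Real.norm_exp_I_mul_ofReal_sub_one_le).trans (le_of_eq ?_)
    rw [Real.norm_eq_abs, show 2 * Real.pi * (k.valMinAbs : ℤ) * (v : ℕ) / L = ((v : ℕ) : ℝ) * θ by
      rw [hθ]; ring, abs_mul, Nat.abs_cast]
  -- the sum is within `Σ_v v|θ| ≤ R²|θ|/2 ≤ R/2` of `R`
  have hdiff : ‖(∑ v : Fin R, (ZMod.stdAddChar (k * ((v : ℕ) : ZMod L)) : ℂ)) - R‖ ≤ (R : ℝ) / 2 := by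
    have hR : ((R : ℕ) : ℂ) = ∑ _v : Fin R, (1 : ℂ) := by simp
    rw [hR, ← Finset.sum_sub_distrib]
    refine (norm_sum_le _ _).trans ?_
    refine (Finset.sum_le_sum fun v _ => hterm v).trans ?_
    rw [← Finset.sum_mul, Fin.sum_univ_eq_sum_range (fun v => ((v : ℕ) : ℝ)) R]
    have hsum : ∑ v ∈ Finset.range R, ((v : ℕ) : ℝ) ≤ (R : ℝ) ^ 2 / 2 := by
      have hnat : (∑ v ∈ Finset.range R, v) * 2 ≤ R * R := by
        rw [Finset.sum_range_id_mul_two]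
        exact Nat.mul_le_mul_left R (Nat.sub_le R 1)
      have hcast : ((∑ v ∈ Finset.range R, v : ℕ) : ℝ) * 2 ≤ (R : ℝ) * R := by exact_mod_cast hnat
      rw [Nat.cast_sum] at hcast
      have hsq : (R : ℝ) ^ 2 = R * R := sq _
      linarith
    have hθR : |θ| * R ≤ 1 := hq
    calc (∑ v ∈ Finset.range R, ((v : ℕ) : ℝ)) * |θ| ≤ (R : ℝ) ^ 2 / 2 * |θ| :=
          mul_le_mul_of_nonneg_right hsum (abs_nonneg _)
      _ = (R : ℝ) / 2 * (|θ| * R) := by ring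
      _ ≤ (R : ℝ) / 2 * 1 := mul_le_mul_of_nonneg_left hθR (by positivity)
      _ = (R : ℝ) / 2 := by ring
  -- reverse triangle inequality
  have hRn : ‖((R : ℕ) : ℂ)‖ = R := by simp
  have h := norm_sub_norm_le ((R : ℕ) : ℂ) (∑ v : Fin R, (ZMod.stdAddChar (k * ((v : ℕ) : ZMod L)) : ℂ))
  rw [hRn, norm_sub_rev] at h
  linarith

/-- The block kernel factorises over coordinates: `Σ_{u ∈ [0,R)^d} χ_m(u) = Πᵢ Σ_{v<R} e(mᵢ v)`. [folklore] -/
private theorem mc_blockKernel_eq_prod {d : ℕ} (m : TorusSite d L) (R : ℕ) :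
    ∑ u : Fin d → Fin R, torusChar m (fun i => ((u i : ℕ) : ZMod L)) =
      ∏ i, ∑ v : Fin R, (ZMod.stdAddChar (m i * ((v : ℕ) : ZMod L)) : ℂ) := by
  rw [Fintype.prod_sum]
  rfl

/-- `F(0) = R^d`. [folklore] -/
private theorem mc_blockKernel_zero {d : ℕ} (R : ℕ) :
    ∑ u : Fin d → Fin R, torusChar (0 : TorusSite d L) (fun i => ((u i : ℕ) : ZMod L)) = (R : ℂ) ^ d := by
  simp

/-- **Lower block-kernel bound on the window** (`d = 2`): if `|q_m| ≤ ε` and `ε R ≤ 1` then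
`|F_R(m)|² ≥ R⁴/16` (each coordinate carries `|q_{m,i}| ≤ |q_m|`, so `|Σ_{v<R} e(mᵢ v)| ≥ R/2`).
Stein–Shakarchi, *Fourier Analysis*, Ch. 2. [folklore] -/
private theorem mc_blockKernel_sq_ge (m : TorusSite 2 L) (R : ℕ) {ε : ℝ} (hε : 0 < ε) (hεR : ε * R ≤ 1)
    (hm : momentumNormSq L m ≤ ε ^ 2) :
    (R : ℝ) ^ 4 / 16 ≤ ‖∑ u : Fin 2 → Fin R, torusChar m (fun i => ((u i : ℕ) : ZMod L))‖ ^ 2 := by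
  rw [mc_blockKernel_eq_prod, norm_prod, Fin.prod_univ_two]
  -- each coordinate momentum is at most `ε`
  have hcoord : ∀ i : Fin 2, |2 * Real.pi * (((m i).valMinAbs : ℤ) : ℝ) / L| * R ≤ 1 := by
    intro i
    have hi : (2 * Real.pi / (L : ℝ)) ^ 2 * (((m i).valMinAbs : ℤ) : ℝ) ^ 2 ≤ ε ^ 2 := by
      rw [momentumNormSq_apply, Fin.sum_univ_two] at hm
      have h0 := sq_nonneg ((((m 0).valMinAbs : ℤ) : ℝ))
      have h1 := sq_nonneg ((((m 1).valMinAbs : ℤ) : ℝ))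
      have hc := sq_nonneg (2 * Real.pi / (L : ℝ))
      fin_cases i
      · simp only [Fin.zero_eta]
        nlinarith
      · simp only [Fin.mk_one]
        nlinarith
    have habs : |2 * Real.pi * (((m i).valMinAbs : ℤ) : ℝ) / L| ≤ ε := by
      have : (2 * Real.pi * (((m i).valMinAbs : ℤ) : ℝ) / L) ^ 2 ≤ ε ^ 2 := by
        calc _ = (2 * Real.pi / (L : ℝ)) ^ 2 * (((m i).valMinAbs : ℤ) : ℝ) ^ 2 := by ring
          _ ≤ ε ^ 2 := hi
      exact abs_le.2 (abs_le_of_sq_le_sq' this hε.le)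
    calc |2 * Real.pi * (((m i).valMinAbs : ℤ) : ℝ) / L| * R ≤ ε * R :=
          mul_le_mul_of_nonneg_right habs (Nat.cast_nonneg _)
      _ ≤ 1 := hεR
  have h0 := mc_half_le_norm_sum_stdAddChar (m 0) R (hcoord 0)
  have h1 := mc_half_le_norm_sum_stdAddChar (m 1) R (hcoord 1)
  have hR : (0 : ℝ) ≤ (R : ℝ) / 2 := by positivity
  have hprod := mul_le_mul h0 h1 hR (norm_nonneg _)
  have hprod2 := pow_le_pow_left₀ (by positivity) hprod 2
  calc (R : ℝ) ^ 4 / 16 = ((R : ℝ) / 2 * ((R : ℝ) / 2)) ^ 2 := by ring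
    _ ≤ _ := hprod2

end Kernel

/-! ### Block Plancherel (adapted from `WeakCouplingBCSWcbcsSsbToTorusLROFejerClosure.lean`, private there) -/

section Plancherel

variable {d L : ℕ} [NeZero L] {n : Type*} [Fintype n]

/-- `z · conj z = |z|²` with `star` spelling and a real cast. [folklore] -/
private theorem mc_mul_star_self_eq_ofReal (z : ℂ) : z * star z = ((‖z‖ ^ 2 : ℝ) : ℂ) := by
  rw [Complex.star_def, Complex.mul_conj']
  push_cast
  rfl

omit [Fintype n] in
/-- Fourier mode of the block family: `Σ_a conj χ_m(a) B_a = F(m) • Σ_y conj χ_m(y) P_y`,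
`F(m) = Σ_u χ_m(u)`. Friedli–Velenik (2017) §10.4. [folklore] -/
private theorem mc_fourierMode_block (P : TorusSite d L → Matrix n n ℂ) (R : ℕ) (m : TorusSite d L) :
    ∑ a : TorusSite d L, conj (torusChar m a) •
        (∑ u : Fin d → Fin R, P (a + fun i => ((u i : ℕ) : ZMod L))) =
      (∑ u : Fin d → Fin R, torusChar m (fun i => ((u i : ℕ) : ZMod L))) •
        ∑ y : TorusSite d L, conj (torusChar m y) • P y := by
  -- adapted from reserve-free tree file WeakCouplingBCSWcbcsSsbToTorusLROFejerClosure.lean (private lemma)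
  rw [Finset.sum_smul]
  simp_rw [Finset.smul_sum]
  rw [Finset.sum_comm]
  refine Finset.sum_congr rfl fun u _ => ?_
  refine Fintype.sum_equiv (Equiv.addRight (fun i => ((u i : ℕ) : ZMod L))) _ _ fun a => ?_
  simp only [Equiv.coe_addRight]
  rw [smul_smul, torusChar_add_right, map_mul, mul_left_comm, torusChar_mul_conj, mul_one]

/-- **Block Plancherel, vector form**: `L^d · Σ_a ‖B_a ψ‖² = Σ_m |F(m)|² ‖Δ(m) ψ‖²` for any matrix family
`P_x`, blocks `B_a = Σ_{u ∈ [0,R)^d} P_{a+u}` and modes `Δ(m) = Σ_y conj χ_m(y) P_y`.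
Kennedy–Lieb–Shastry, PRL 61 (1988) 2582 (Parseval sum rule). [folklore] -/
private theorem mc_block_plancherel (P : TorusSite d L → Matrix n n ℂ) (R : ℕ) (ψ : n → ℂ) :
    (L : ℝ) ^ d * ∑ a : TorusSite d L,
        (star ((∑ u : Fin d → Fin R, P (a + fun i => ((u i : ℕ) : ZMod L))) *ᵥ ψ) ⬝ᵥ
          ((∑ u : Fin d → Fin R, P (a + fun i => ((u i : ℕ) : ZMod L))) *ᵥ ψ)).re =
      ∑ m : TorusSite d L,
        ‖∑ u : Fin d → Fin R, torusChar m (fun i => ((u i : ℕ) : ZMod L))‖ ^ 2 *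
          (star ((∑ y, conj (torusChar m y) • P y) *ᵥ ψ) ⬝ᵥ
            ((∑ y, conj (torusChar m y) • P y) *ᵥ ψ)).re := by
  -- adapted from tree file WeakCouplingBCSWcbcsSsbToTorusLROFejerClosure.lean (private lemma)
  have h := sum_conjTranspose_mul_fourierMode
    (fun a => ∑ u : Fin d → Fin R, P (a + fun i => ((u i : ℕ) : ZMod L)))
  simp only [mc_fourierMode_block, conjTranspose_smul, Matrix.smul_mul, Matrix.mul_smul, smul_smul,
    mc_mul_star_self_eq_ofReal] at h
  have h' := congrArg (fun T => (star ψ ⬝ᵥ (T *ᵥ ψ)).re) h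
  simp only [sum_mulVec, dotProduct_sum, smul_mulVec, dotProduct_smul, smul_eq_mul,
    Complex.re_sum, Complex.re_ofReal_mul] at h'
  have hc : ((L : ℂ) ^ d) = (((L : ℝ) ^ d : ℝ) : ℂ) := by push_cast; rfl
  rw [hc, Complex.re_ofReal_mul, Complex.re_sum] at h'
  simp_rw [star_mulVec_dotProduct_mulVec]
  exact h'.symm

end Plancherel

/-! ### The Fejér majorant of the window -/

section Majorant

variable (g : Site 2 → ℝ) (L : ℕ) [NeZero L]

/-- **Block Plancherel in Fejér normalisation** (`0 < R`, `2R ≤ L`, any form factor, any vector):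
`R² · T_R(ψ) = Σ_m |F_R(m)|² S_ψ(m)` — the tent identity `Σ_a ‖B_a ψ‖² = R² T_R(ψ)` combined with block
Plancherel `Σ_a ‖B_a ψ‖² = Σ_m |F_R(m)|² S_ψ(m)`. [folklore] -/
theorem sq_mul_fejerBoxCorr_eq_sum_blockKernel_sq_mul (R : ℕ) (hR : 0 < R) (hRL : 2 * R ≤ L)
    (ψ : Fock (Orb (FermionTorus 2 L))) :
    (R : ℝ) ^ 2 * ∑ x : TorusSite 2 L, ∑ y : TorusSite 2 L,
        (∏ i : Fin 2, max 0 (1 - |(((y i - x i).valMinAbs : ℤ) : ℝ)| / (R : ℝ))) *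
          (star (localPair g L x *ᵥ ψ) ⬝ᵥ (localPair g L y *ᵥ ψ)).re =
      ∑ m : TorusSite 2 L, ‖∑ u : Fin 2 → Fin R, torusChar m (fun i => ((u i : ℕ) : ZMod L))‖ ^ 2 *
        pairStructureFactor g L ψ m := by
  have hLpos : (0 : ℝ) < L := Nat.cast_pos.2 (Nat.pos_of_ne_zero (NeZero.ne L))
  have hL2 : (L : ℝ) ^ 2 ≠ 0 := pow_ne_zero _ hLpos.ne'
  rw [← FunctionFieldCertificateAssembly.re_sum_star_blockMulVec_dotProduct_eq R hR hRL (localPair g L) ψ]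
  have h := mc_block_plancherel (localPair g L) R ψ
  simp only [← pairFieldAt_eq_sum_torusChar] at h
  have hSm : ∀ m, (star (pairFieldAt g L m *ᵥ ψ) ⬝ᵥ (pairFieldAt g L m *ᵥ ψ)).re =
      (L : ℝ) ^ 2 * pairStructureFactor g L ψ m := fun m => by
    rw [pairStructureFactor_apply, mul_div_cancel₀ _ hL2]
  simp only [hSm] at h
  refine mul_left_cancel₀ hL2 ?_
  rw [Complex.re_sum, h, Finset.mul_sum]
  exact Finset.sum_congr rfl fun m _ => by ring

/-- **Kinematics: the condensate never exceeds the block order.** For `0 < R`, `2R ≤ L`, any form factor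
and EVERY Fock vector, `S_ψ(0) ≤ T_R(ψ)/R²` (`Σ_m |F_R(m)|² S_ψ(m) ≥ |F_R(0)|² S_ψ(0) = R⁴ S_ψ(0)`):
the left side of the mesoscopic ceiling (MC) is a genuine nonnegative defect — the Cauchy–Schwarz defect of
the `L²` block pair-removal vectors `B_a ψ`, `Σ_a B_a = R² Δ_g`. [folklore] -/
theorem condensate_le_blockOrder (R : ℕ) (hR : 0 < R) (hRL : 2 * R ≤ L)
    (ψ : Fock (Orb (FermionTorus 2 L))) :
    pairStructureFactor g L ψ 0 ≤
      (∑ x : TorusSite 2 L, ∑ y : TorusSite 2 L,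
        (∏ i : Fin 2, max 0 (1 - |(((y i - x i).valMinAbs : ℤ) : ℝ)| / (R : ℝ))) *
          (star (localPair g L x *ᵥ ψ) ⬝ᵥ (localPair g L y *ᵥ ψ)).re) / (R : ℝ) ^ 2 := by
  have hRpos : (0 : ℝ) < R := Nat.cast_pos.2 hR
  have hP := sq_mul_fejerBoxCorr_eq_sum_blockKernel_sq_mul g L R hR hRL ψ
  set F : TorusSite 2 L → ℂ := fun m => ∑ u : Fin 2 → Fin R, torusChar m (fun i => ((u i : ℕ) : ZMod L))
    with hF
  have hF0 : ‖F 0‖ ^ 2 = (R : ℝ) ^ 4 := by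
    simp only [hF, mc_blockKernel_zero, norm_pow, Complex.norm_natCast]
    ring
  have hsingle : ‖F 0‖ ^ 2 * pairStructureFactor g L ψ 0 ≤
      ∑ m : TorusSite 2 L, ‖F m‖ ^ 2 * pairStructureFactor g L ψ m :=
    Finset.single_le_sum (f := fun m => ‖F m‖ ^ 2 * pairStructureFactor g L ψ m)
      (fun m _ => mul_nonneg (sq_nonneg _) (pairStructureFactor_nonneg g L ψ m)) (Finset.mem_univ 0)
  rw [hF0] at hsingle
  rw [le_div_iff₀ (by positivity)]
  have hT : ∑ m : TorusSite 2 L, ‖F m‖ ^ 2 * pairStructureFactor g L ψ m =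
      (R : ℝ) ^ 2 * ∑ x : TorusSite 2 L, ∑ y : TorusSite 2 L,
        (∏ i : Fin 2, max 0 (1 - |(((y i - x i).valMinAbs : ℤ) : ℝ)| / (R : ℝ))) *
          (star (localPair g L x *ᵥ ψ) ⬝ᵥ (localPair g L y *ᵥ ψ)).re := hP.symm
  rw [hT] at hsingle
  -- `R⁴ S(0) ≤ R² T` gives `S(0) R² ≤ T`
  have hR2 : (0 : ℝ) < (R : ℝ) ^ 2 := by positivity
  nlinarith [hsingle]

end Majorant

/-! ### The Fejér majorant of the window (registered stub form: all binders universal) -/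

/-- **Fejér MAJORANT of the window** (dual to the landed minorant `FunctionFieldCertificateAssembly.fejer_glue`).
For `0 < R`, `2R ≤ L`, `0 < ε` with `ε R ≤ 1`, any form factor `g` and EVERY Fock vector `ψ`:
`Σ_{m ≠ 0, |q_m| ≤ ε} S_ψ(m) ≤ 16 · (T_R(ψ)/R² - S_ψ(0))`.
Proof: `R² T_R(ψ) = Σ_m |F_R(m)|² S_ψ(m)` (block Plancherel + tent identity); the `m = 0` term is
`R⁴ S_ψ(0)`; on the window `|F_R(m)|² ≥ R⁴/16` (`mc_blockKernel_sq_ge`); all other terms are `≥ 0`.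
Kennedy–Lieb–Shastry, PRL 61 (1988) 2582; Stein–Shakarchi, *Fourier Analysis*, Ch. 2. [folklore] -/
theorem windowSum_le_fejerMajorant : ∀ (g : Site 2 → ℝ) (L : ℕ) [NeZero L] (R : ℕ), 0 < R → 2 * R ≤ L → ∀ ε : ℝ, 0 < ε → ε * R ≤ 1 → ∀ ψ : Fock (Orb (FermionTorus 2 L)), (∑ m : TorusSite 2 L, if m ≠ 0 ∧ momentumNormSq L m ≤ ε ^ 2 then pairStructureFactor g L ψ m else 0) ≤ 16 * ((∑ x : TorusSite 2 L, ∑ y : TorusSite 2 L, (∏ i : Fin 2, max 0 (1 - |(((y i - x i).valMinAbs : ℤ) : ℝ)| / (R : ℝ))) * (star (localPair g L x *ᵥ ψ) ⬝ᵥ (localPair g L y *ᵥ ψ)).re) / (R : ℝ) ^ 2 - pairStructureFactor g L ψ 0) := by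
  intro g L _ R hR hRL ε hε hεR ψ
  have hRpos : (0 : ℝ) < R := Nat.cast_pos.2 hR
  have hP := sq_mul_fejerBoxCorr_eq_sum_blockKernel_sq_mul g L R hR hRL ψ
  set T : ℝ := ∑ x : TorusSite 2 L, ∑ y : TorusSite 2 L,
        (∏ i : Fin 2, max 0 (1 - |(((y i - x i).valMinAbs : ℤ) : ℝ)| / (R : ℝ))) *
          (star (localPair g L x *ᵥ ψ) ⬝ᵥ (localPair g L y *ᵥ ψ)).re with hT
  set S : TorusSite 2 L → ℝ := pairStructureFactor g L ψ with hS
  set F : TorusSite 2 L → ℂ := fun m => ∑ u : Fin 2 → Fin R, torusChar m (fun i => ((u i : ℕ) : ZMod L))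
    with hF
  have hSnn : ∀ m, 0 ≤ S m := fun m => pairStructureFactor_nonneg g L ψ m
  have hF0 : ‖F 0‖ ^ 2 = (R : ℝ) ^ 4 := by
    simp only [hF, mc_blockKernel_zero, norm_pow, Complex.norm_natCast]
    ring
  -- pointwise: window terms from below by `R⁴/16 · S`, the zero mode exactly, the rest by `0`
  have hpt : ∀ m ∈ (Finset.univ : Finset (TorusSite 2 L)),
      (if m = 0 then (R : ℝ) ^ 4 * S m else 0) +
        (R : ℝ) ^ 4 / 16 * (if m ≠ 0 ∧ momentumNormSq L m ≤ ε ^ 2 then S m else 0) ≤ ‖F m‖ ^ 2 * S m := by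
    intro m _
    by_cases hm : m = 0
    · subst hm
      simp only [if_true, ne_eq, not_true_eq_false, false_and, if_false, mul_zero, add_zero, hF0]
      exact le_rfl
    · rw [if_neg hm]
      by_cases hq : momentumNormSq L m ≤ ε ^ 2
      · rw [if_pos ⟨hm, hq⟩, zero_add]
        exact mul_le_mul_of_nonneg_right (mc_blockKernel_sq_ge m R hε hεR hq) (hSnn m)
      · rw [if_neg (fun h => hq h.2), mul_zero, add_zero]
        exact mul_nonneg (sq_nonneg _) (hSnn m)
  have hsum := Finset.sum_le_sum hpt
  rw [Finset.sum_add_distrib, Fintype.sum_ite_eq', ← Finset.mul_sum, ← hP] at hsum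
  -- `R⁴ S 0 + (R⁴/16) W ≤ R² T`
  have hR2 : (0 : ℝ) < (R : ℝ) ^ 2 := by positivity
  have hR4 : (0 : ℝ) < (R : ℝ) ^ 4 := by positivity
  have hW : (∑ m : TorusSite 2 L, if m ≠ 0 ∧ momentumNormSq L m ≤ ε ^ 2 then S m else 0) ≤
      16 * (T / (R : ℝ) ^ 2 - S 0) := by
    rw [mul_sub, mul_div_assoc']
    rw [le_sub_iff_add_le, le_div_iff₀ hR2]
    nlinarith [hsum]
  exact hW


end Summit.HubbardSuperconductivity.HubbardSuperconductivity.Theorems.WindowInfraredBound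

end
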